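import Mathlib.MeasureTheory.Integral.IntervalIntegral.Periodic
import Mathlib.MeasureTheory.Integral.IntervalIntegral.FundThmCalculus
import Literature.MathematicalPhysics.KineticTheory.InfiniteChainGibbsStationarity
import HarnessLib

/-!
# Orbit measures of the infinite chain: closed orbits carry time-invariant states

Support file (`--supports stmt-AtomisticToContinuum-13980`, route `ParityLiouvilleSeed`, decl
`Summit.AtomisticToContinuum.FouriersLaw.Theses.ParityLiouvilleSeed.LiouvilleForHeat`; equally for
the crux `ZeroCurrentRigidity`, `stmt-AtomisticToContinuum-12073`). General tools for building
EXPLICIT members of the hypothesis classes of these statements out of explicit solutions; used by the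
companion file `ParityLiouvilleSeedLiouvilleForHeatRadiatingWave` (a current-carrying space-time
invariant state of the anharmonic chain, showing that regularity cannot be dropped).

For any chain `P` with `C²` potentials and any solution `γ` of the infinite equations of motion
(`OscillatorChain.IsSolution`), the occupation measure of the orbit piece `γ|(0, τ]`,
`∫_{(0,τ]} δ_{γ(s)} ds = (volume|_{(0,τ]}).map γ`, and its normalisation
`ν_γ = τ⁻¹ ∫_0^τ δ_{γ(s)} ds`:

* `hasDerivAt_comp_boxRestrictAt_of_isSolution` — chain rule `d/ds f(γ s) = (𝒜f)(γ s)` for local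
  `f = g ∘ box` (the full-solution twin of `IsSeveredSolution.hasDerivAt_comp_boxRestrictAt`);
* `isTimeInvariant_map_restrict_of_isSolution` — if `γ τ = γ 0` the occupation measure is time
  invariant in the generator sense (`IsTimeInvariant`): `∫ 𝒜f = f(γ τ) - f(γ 0) = 0`, and `𝒜f` is
  integrable because it is continuous along the orbit;
* `isProbabilityMeasure_orbitMeasure`, `integral_orbitMeasure` (`∫ F dν_γ = τ⁻¹∫_0^τ F(γ s) ds`),
  `integrable_orbitMeasure`;
* `isShiftInvariant_orbitMeasure` — if `γ` is `τ`-periodic and the lattice shift acts on it as a time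
  shift, `shift (γ t) = γ (t + c)`, then `ν_γ` is shift invariant (translation invariance of Haar
  measure on `ℝ/τℤ`, `AddCircle.measurePreserving_mk`).
-/

noncomputable section

namespace Summit.AtomisticToContinuum.FouriersLaw.Theorems.ParityLiouvilleSeed

open MeasureTheory Set Filter Topology
open scoped ENNReal
open Literature.MathematicalPhysics.KineticTheory.HeatConduction

/-! ### Orbit measures of solutions of the infinite chain -/

/-- A continuous map into the configuration space `ℤ → ℝ × ℝ` is measurable (product σ-algebra).
[folklore] -/
theorem measurable_of_continuous_chainConfig {α : Type*} [TopologicalSpace α] [MeasurableSpace α]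
    [OpensMeasurableSpace α] {F : α → ChainConfig} (hF : Continuous F) : Measurable F :=
  measurable_pi_iff.mpr fun x => ((continuous_apply x).comp hF).measurable

/-- A solution of the infinite equations of motion is a continuous curve of configurations.
[folklore] -/
theorem continuous_of_isSolution {P : OscillatorChain} {γ : ℝ → ChainConfig} (hγ : P.IsSolution γ) :
    Continuous γ := by
  refine continuous_pi fun x => ?_
  have h1 : Continuous fun s => (γ s x).1 :=
    continuous_iff_continuousAt.mpr fun t => (hγ x t).1.continuousAt
  have h2 : Continuous fun s => (γ s x).2 :=
    continuous_iff_continuousAt.mpr fun t => (hγ x t).2.continuousAt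
  exact h1.prodMk h2

/-- **Chain rule along a solution.** If `γ` solves the infinite equations of motion and `g` is
differentiable, then `d/dt g(box_{a,n}(γ t)) = 𝒜(g ∘ box_{a,n})(γ t)`. [folklore] -/
theorem hasDerivAt_comp_boxRestrictAt_of_isSolution {P : OscillatorChain} {γ : ℝ → ChainConfig}
    (hγ : P.IsSolution γ) (a : ℤ) (n : ℕ) {g : (Fin (n + 1) → ℝ × ℝ) → ℝ}
    (hg : Differentiable ℝ g) (t : ℝ) :
    HasDerivAt (fun s => g (boxRestrictAt a n (γ s)))
      (liouvilleZ P (g ∘ boxRestrictAt a n) (γ t)) t := by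
  have hc : HasDerivAt (fun s => boxRestrictAt a n (γ s))
      (fun i => ((γ t (a + i)).2, P.force (γ t) (a + i))) t := by
    rw [hasDerivAt_pi]
    intro i
    exact ((hγ (a + i) t).1).prodMk ((hγ (a + i) t).2)
  have hcomp := ((hg (boxRestrictAt a n (γ t))).hasFDerivAt).comp_hasDerivAt t hc
  have hv : (fun i : Fin (n + 1) => ((γ t (a + (i : ℤ))).2, P.force (γ t) (a + (i : ℤ)))) =
      ∑ i : Fin (n + 1), ((γ t (a + i)).2 • (Pi.single i ((1 : ℝ), (0 : ℝ)) : Fin (n + 1) → ℝ × ℝ) +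
        P.force (γ t) (a + i) • (Pi.single i ((0 : ℝ), (1 : ℝ)) : Fin (n + 1) → ℝ × ℝ)) :=
    OscillatorChain.pi_eq_sum_smul_single _
  have heq : fderiv ℝ g (boxRestrictAt a n (γ t)) (fun i => ((γ t (a + i)).2, P.force (γ t) (a + i))) =
      liouvilleZ P (g ∘ boxRestrictAt a n) (γ t) := by
    rw [hv, map_sum, liouvilleZ_comp_boxRestrictAt P a n (γ t) (hg _)]
    refine Finset.sum_congr rfl fun i _ => ?_
    rw [map_add, map_smul, map_smul, smul_eq_mul, smul_eq_mul]
  rw [← heq]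
  exact hcomp

/-- Continuity of `s ↦ 𝒜(g ∘ box_{a,n})(γ s)` along a solution `γ`, for `g ∈ C¹` and `U, V ∈ C²`.
[folklore] -/
theorem continuous_liouvilleZ_comp_of_isSolution {P : OscillatorChain} (hU : ContDiff ℝ 2 P.U)
    (hV : ContDiff ℝ 2 P.V) {γ : ℝ → ChainConfig} (hγ : P.IsSolution γ) (a : ℤ) (n : ℕ)
    {g : (Fin (n + 1) → ℝ × ℝ) → ℝ} (hg : ContDiff ℝ 1 g) :
    Continuous fun s => liouvilleZ P (g ∘ boxRestrictAt a n) (γ s) := by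
  have hγc := continuous_of_isSolution hγ
  have hgd : Differentiable ℝ g := hg.differentiable one_ne_zero
  have heq : (fun s => liouvilleZ P (g ∘ boxRestrictAt a n) (γ s)) =
      fun s => ∑ i : Fin (n + 1),
        ((γ s (a + i)).2 * fderiv ℝ g (boxRestrictAt a n (γ s)) (Pi.single i (1, 0)) +
        P.force (γ s) (a + i) * fderiv ℝ g (boxRestrictAt a n (γ s)) (Pi.single i (0, 1))) :=
    funext fun s => liouvilleZ_comp_boxRestrictAt P a n _ (hgd _)
  rw [heq]
  have hbox : Continuous fun s => boxRestrictAt a n (γ s) :=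
    continuous_pi fun i => (continuous_apply (a + (i : ℤ))).comp hγc
  have hD : ∀ v : Fin (n + 1) → ℝ × ℝ, Continuous fun s =>
      fderiv ℝ g (boxRestrictAt a n (γ s)) v := fun v =>
    ((ContinuousLinearMap.apply ℝ ℝ v).continuous.comp (hg.continuous_fderiv one_ne_zero)).comp hbox
  refine continuous_finsetSum _ fun i _ => ?_
  exact ((continuous_snd.comp ((continuous_apply (a + (i : ℤ))).comp hγc)).mul (hD _)).add
    ((OscillatorChain.continuous_force_comp hU hV hγc _).mul (hD _))

/-- **Fundamental theorem of calculus along a solution**: for `f = g ∘ box_{a,n}`, `g ∈ C¹`,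
`∫_0^t (𝒜f)(γ s) ds = f(γ t) - f(γ 0)`. [folklore] -/
theorem intervalIntegral_liouvilleZ_comp_of_isSolution {P : OscillatorChain} (hU : ContDiff ℝ 2 P.U)
    (hV : ContDiff ℝ 2 P.V) {γ : ℝ → ChainConfig} (hγ : P.IsSolution γ) (a : ℤ) (n : ℕ)
    {g : (Fin (n + 1) → ℝ × ℝ) → ℝ} (hg : ContDiff ℝ 1 g) (t : ℝ) :
    ∫ s in (0 : ℝ)..t, liouvilleZ P (g ∘ boxRestrictAt a n) (γ s) =
      g (boxRestrictAt a n (γ t)) - g (boxRestrictAt a n (γ 0)) := by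
  have hderiv : ∀ s : ℝ, HasDerivAt (fun s => g (boxRestrictAt a n (γ s)))
      (liouvilleZ P (g ∘ boxRestrictAt a n) (γ s)) s := fun s =>
    hasDerivAt_comp_boxRestrictAt_of_isSolution hγ a n (hg.differentiable one_ne_zero) s
  rw [intervalIntegral.integral_eq_sub_of_hasDerivAt (fun s _ => hderiv s)
    ((continuous_liouvilleZ_comp_of_isSolution hU hV hγ a n hg).intervalIntegrable _ _)]

/-- **Closed orbit pieces carry time-invariant measures.** Let `U, V ∈ C²` and let `γ` solve the
infinite equations of motion with `γ τ = γ 0` (`τ ≥ 0`). Then the occupation measure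
`∫_{(0,τ]} δ_{γ(s)} ds` of the orbit piece is time invariant in the generator sense: for every
local test function `f`, `𝒜f` is integrable (it is continuous along the orbit) and
`∫ 𝒜f = f(γ τ) - f(γ 0) = 0`. [folklore] -/
theorem isTimeInvariant_map_restrict_of_isSolution {P : OscillatorChain} (hU : ContDiff ℝ 2 P.U)
    (hV : ContDiff ℝ 2 P.V) {γ : ℝ → ChainConfig} (hγ : P.IsSolution γ) {τ : ℝ} (hτ : 0 ≤ τ)
    (hcl : γ τ = γ 0) :
    IsTimeInvariant P ((volume.restrict (Ioc (0 : ℝ) τ)).map γ) := by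
  have hγm : Measurable γ := measurable_of_continuous_chainConfig (continuous_of_isSolution hγ)
  intro f hf
  have hFm : Measurable (liouvilleZ P f) := hf.measurable_liouvilleZ P
  obtain ⟨R, g, hg, -, -, rfl⟩ := hf
  rw [boxRestrict_eq_boxRestrictAt] at hFm ⊢
  have hcont := continuous_liouvilleZ_comp_of_isSolution hU hV hγ (-(R : ℤ)) (2 * R) hg
  refine ⟨?_, ?_⟩
  · rw [integrable_map_measure hFm.aestronglyMeasurable hγm.aemeasurable]
    exact hcont.integrableOn_Ioc
  · rw [integral_map hγm.aemeasurable hFm.aestronglyMeasurable, ← intervalIntegral.integral_of_le hτ,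
      intervalIntegral_liouvilleZ_comp_of_isSolution hU hV hγ _ _ hg, hcl, sub_self]

/-- Time invariance is preserved under scaling the measure by a finite constant. [folklore] -/
theorem isTimeInvariant_smul_measure {P : OscillatorChain} {μ : Measure ChainConfig}
    (h : IsTimeInvariant P μ) {c : ℝ≥0∞} (hc : c ≠ ∞) : IsTimeInvariant P (c • μ) := fun f hf =>
  ⟨(h f hf).1.smul_measure hc, by rw [integral_smul_measure, (h f hf).2, smul_zero]⟩

/-- The normalised occupation measure `τ⁻¹ ∫_{(0,τ]} δ_{γ(s)} ds` of a measurable curve is a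
probability measure (`τ > 0`). [folklore] -/
theorem isProbabilityMeasure_orbitMeasure {γ : ℝ → ChainConfig} (hγm : Measurable γ) {τ : ℝ}
    (hτ : 0 < τ) :
    IsProbabilityMeasure ((ENNReal.ofReal τ)⁻¹ • (volume.restrict (Ioc (0 : ℝ) τ)).map γ) := by
  constructor
  rw [Measure.smul_apply, Measure.map_apply hγm MeasurableSet.univ, Set.preimage_univ,
    Measure.restrict_apply_univ, Real.volume_Ioc, sub_zero, smul_eq_mul,
    ENNReal.inv_mul_cancel ((ENNReal.ofReal_pos.mpr hτ).ne') ENNReal.ofReal_ne_top]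

/-- Expectations in the normalised occupation measure are time averages along the curve:
`∫ F dν_γ = τ⁻¹ ∫_0^τ F(γ s) ds` (measurable `F`). [folklore] -/
theorem integral_orbitMeasure {γ : ℝ → ChainConfig} (hγm : Measurable γ) {τ : ℝ} (hτ : 0 < τ)
    {F : ChainConfig → ℝ} (hF : Measurable F) :
    ∫ σ, F σ ∂((ENNReal.ofReal τ)⁻¹ • (volume.restrict (Ioc (0 : ℝ) τ)).map γ) =
      τ⁻¹ * ∫ s in (0 : ℝ)..τ, F (γ s) := by
  rw [integral_smul_measure, integral_map hγm.aemeasurable hF.aestronglyMeasurable,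
    intervalIntegral.integral_of_le hτ.le, ENNReal.toReal_inv, ENNReal.toReal_ofReal hτ.le,
    smul_eq_mul]

/-- A measurable observable that is continuous along the curve is integrable for the normalised
occupation measure (`τ > 0`). [folklore] -/
theorem integrable_orbitMeasure {γ : ℝ → ChainConfig} (hγm : Measurable γ) {τ : ℝ} (hτ : 0 < τ)
    {F : ChainConfig → ℝ} (hF : Measurable F) (hc : Continuous fun s => F (γ s)) :
    Integrable F ((ENNReal.ofReal τ)⁻¹ • (volume.restrict (Ioc (0 : ℝ) τ)).map γ) := by
  refine Integrable.smul_measure ?_ (ENNReal.inv_ne_top.mpr (ENNReal.ofReal_pos.mpr hτ).ne')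
  rw [integrable_map_measure hF.aestronglyMeasurable hγm.aemeasurable]
  exact hc.integrableOn_Ioc

/-- **Lattice shift = time shift ⇒ shift invariance.** If `γ` is a continuous `τ`-periodic curve of
configurations (`τ > 0`) on which the lattice shift acts as a time shift, `shift (γ t) = γ (t + c)`,
then its normalised occupation measure over a period is shift invariant (translation invariance of
Haar measure on the circle `ℝ/τℤ`). [folklore] -/
theorem isShiftInvariant_orbitMeasure {γ : ℝ → ChainConfig} (hγc : Continuous γ) {τ : ℝ} (hτ : 0 < τ)
    (hper : Function.Periodic γ τ) {c : ℝ} (hshift : ∀ t, shift (γ t) = γ (t + c)) :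
    IsShiftInvariant ((ENNReal.ofReal τ)⁻¹ • (volume.restrict (Ioc (0 : ℝ) τ)).map γ) := by
  haveI : Fact (0 < τ) := ⟨hτ⟩
  have hγm : Measurable γ := measurable_of_continuous_chainConfig hγc
  have hlc : Continuous (hper.lift : AddCircle τ → ChainConfig) := by
    unfold Function.Periodic.lift
    exact hγc.quotient_liftOn' _
  have hlm : Measurable (hper.lift : AddCircle τ → ChainConfig) := measurable_of_continuous_chainConfig hlc
  have hcomp : (hper.lift ∘ ((↑) : ℝ → AddCircle τ)) = γ := funext fun t => hper.lift_coe t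
  have hmk := AddCircle.measurePreserving_mk τ (0 : ℝ)
  rw [zero_add] at hmk
  have hmapγ : (volume.restrict (Ioc (0 : ℝ) τ)).map γ = (volume : Measure (AddCircle τ)).map hper.lift := by
    have h1 : (volume.restrict (Ioc (0 : ℝ) τ)).map γ =
        (volume.restrict (Ioc (0 : ℝ) τ)).map (hper.lift ∘ ((↑) : ℝ → AddCircle τ)) := by
      rw [hcomp]
    rw [h1, ← Measure.map_map hlm AddCircle.measurable_mk', hmk.map_eq]
  unfold IsShiftInvariant
  rw [Measure.map_smul, hmapγ, Measure.map_map shift_measurable hlm]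
  congr 1
  have hsc : shift ∘ hper.lift = hper.lift ∘ (fun θ : AddCircle τ => θ + ((c : ℝ) : AddCircle τ)) := by
    funext θ
    induction θ using QuotientAddGroup.induction_on with
    | H t =>
      simp only [Function.comp_apply]
      rw [← AddCircle.coe_add, hper.lift_coe, hper.lift_coe]
      exact hshift t
  rw [hsc, ← Measure.map_map hlm (measurable_add_const _), map_add_right_eq_self]

end Summit.AtomisticToContinuum.FouriersLaw.Theorems.ParityLiouvilleSeed

end
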